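import Summits.HodgeConjecture.HodgeConjecture.Theorems.K2LiuRankOneCartanAnyPlace          -- ★ (F1, this seat): torus pairs, `map_ne_zero_of_vσ`, `v_pow_eq`, Weyl flip `permMatrix_swap_mul_diagonal_mul`
import Summits.HodgeConjecture.HodgeConjecture.Theorems.K2E3RankOneTransvectionNormalForm   -- ★ (K2E3): `antidiagonal_two_over` (`J₀ = !![0,1;1,0]`)
import HarnessLib

/-!
# The double coset `K₀ · diag(x, (σx)⁻¹) · K₀` of `U(σ, J₀)(K)` is covered by `2 · #(net)` left `K₀`-cosets, for a net of the ANTI-FIXED integers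
# modulo `v ≤ v(x)²` — ANY isometric involution, ANY place (the VOLUME organ of (26-r), group-theoretic half)

Track B ∕ K2-LIT, hLiu418 = stmt-HodgeConjecture-24832; socket #32dR `sig_K2LiuDoublingHeightDecayLocalR2` (U5d ED. 5 :554) through ★
`doublingHeightDecayLocalR2_of_nonsplitData` (K2Liu-p04 g3): the rank-one Cartan decay datum at an isotropic non-split `v ∈ S` needs the VOLUME GROWTH
`ν(K₀ b_j K₀) ≤ C₁·Q^j` along the ★ (F1) family `b_j = diag(ϖ^j, (σϖ^j)⁻¹)` (`K2LiuRankOneCartanAnyPlace.isCartanFamily_unitaryInt_two`, p857463).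
LEAD F0P6-plan (g11) deal (26-r) → K2Liu-p04 (g4); REPORT-FIRST `K2/K2Liu-p04/g4/REPORT-FIRST-26r-IsotropicAnyPlace.K2Liup04g4.md` (F2).

THE STATEMENT (`doubleCoset_subset_biUnion_cosets`).  `K` a field with `v : K → ℤᵐ⁰`, `σ` an involution with `v ∘ σ = v`, `K₀ = U(σ, J₀) ∩ GL₂(𝒪)`,
`b ∈ U(σ, J₀)` with matrix `diag(x, (σx)⁻¹)`, `v x = exp(−j)`, and `R₀ ⊂ 𝒪⁰ := {ρ : v ρ ≤ 1, σρ = −ρ}` (the ANTI-FIXED integers, Rogawski's trace-zero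
line) a finite NET modulo `v ≤ exp(−2j)` (`∀ ρ ∈ 𝒪⁰ ∃ ρ' ∈ R₀, v(ρ − ρ') ≤ exp(−2j)`).  THEN there is a finite `R ⊂ U(σ, J₀)` with `#R ≤ 2·#R₀` and
`K₀ b K₀ ⊆ ⋃_{r ∈ R} (r b)·K₀`.  Hence (F4) `ν(K₀ b K₀) ≤ 2·#R₀·ν(K₀)` for every left-invariant `ν`, and with (F2b) `#R₀ = [𝒪⁰ : 𝒪⁰ ∩ 𝔭^{2j}] ≤ D·q^j`.
THE PROOF (the Iwasawa cells of `K₀ b K₀ ∕ K₀`, [BruhatTits1972, (4.4.4)]; [Macdonald1971, Ch. V §3]): for `k = [[p,q],[r,s]] ∈ K₀` the second column is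
primitive and isotropic (`σ(q)s + σ(s)q = 0`, ★ `sum_map_mul_rev_apply_eq`), so either `s` is a unit and `ρ := q∕s ∈ 𝒪⁰` (tag A), or `q` is a unit and the
Weyl flip `w` reduces to tag A (tag B); in tag A, for the net point `ρ'` of `ρ`, `u(ρ') := [[1,ρ'],[0,1]] ∈ K₀` and `(u(ρ')b)⁻¹·(k b) = b⁻¹u(−ρ')kb =
[[p−ρ'r, s(ρ−ρ')∕(xσx)], [r·xσx, s]]` is INTEGRAL (`v(s(ρ−ρ')) ≤ exp(−2j) = v(xσx)`), i.e. `k b ∈ u(ρ')b·K₀`; in tag B `k b ∈ w·u(ρ')b·K₀`.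
Theorems only; no `def`, no `sorry`, default heartbeats.  [BruhatTits1972, (4.4.4)]; [Macdonald1971, Ch. V §3]; [Rogawski1990, §1.10 p. 14]; [SerreTrees1980, II.1.1].
HONEST LABEL: HC_CM is proved only modulo the 7 printed citations (2 remaining named inputs: hLiu418 = stmt-HodgeConjecture-24832, h413 =
stmt-HodgeConjecture-24833) until rung 0 closes; count-neutral helper toward #32dR (organ (26-r)), retires nothing by itself.
-/

set_option autoImplicit false
-- the mandated namespace repeats the single-problem summit's segment (`HodgeConjecture.HodgeConjecture`)
set_option linter.dupNamespace false

noncomputable section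

open scoped Valued WithZero Matrix MatrixGroups
open Matrix

namespace Summit.HodgeConjecture.HodgeConjecture.Cruxes.HLiu418.K2LiuRankOneCosetCoverAnyPlace

open Literature.NumberTheory.Automorphic Literature.NumberTheory.Automorphic.HermitianLattice
open Summit.HodgeConjecture.HodgeConjecture.Cruxes.HLiu418.K2LiuRankOneCartanAnyPlace
open Summit.HodgeConjecture.HodgeConjecture.Cruxes.H413.K2E3RankOneTransvectionNormalForm (antidiagonal_two_over)

variable {K : Type} [Field K] [Valued K ℤᵐ⁰] {σ : K →+* K}

/-! ## §1 Matrices of `U(σ, J₀)`, `N = 2`: the form, the unipotent `u(ρ)`, inverses -/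

omit [Valued K ℤᵐ⁰] in
/-- **the unipotent `u(ρ) = [[1, ρ], [0, 1]]` lies in `U(σ, J₀)` iff `ρ` is ANTI-FIXED** (`σρ = −ρ`; here: if).  [cite: Rogawski1990, §1.10 p. 14] -/
theorem unipotent_mem_unitaryGroupOfForm {ρ : K} (hρ : σ ρ = -ρ) :
    (⟨!![1, ρ; 0, 1], !![1, -ρ; 0, 1], by simp [Matrix.one_fin_two], by simp [Matrix.one_fin_two]⟩ :
        GL (Fin 2) K) ∈ unitaryGroupOfForm σ ((StdForm.antidiagonal 2).over K) := by
  rw [mem_unitaryGroupOfForm_iff, antidiagonal_two_over (K := K)]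
  change (!![1, ρ; 0, 1].map σ)ᵀ * !![0, 1; 1, 0] * !![1, ρ; 0, 1] = !![0, 1; 1, 0]
  have hmap : (!![1, ρ; 0, 1] : Matrix (Fin 2) (Fin 2) K).map σ = !![1, σ ρ; 0, 1] := by
    ext i j; fin_cases i <;> fin_cases j <;> simp
  rw [hmap, hρ]
  ext i j
  fin_cases i <;> fin_cases j <;> simp [Matrix.mul_apply, Fin.sum_univ_two]

omit [Valued K ℤᵐ⁰] in
/-- the second column of `k ∈ U(σ, J₀)` is isotropic: `σ(k₀₁)·k₁₁ + σ(k₁₁)·k₀₁ = 0`. [cite: Rogawski1990, §1.9 p. 13] -/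
theorem col_one_isotropic (k : unitaryGroupOfForm σ ((StdForm.antidiagonal 2).over K)) :
    σ (((k : GL (Fin 2) K) : Matrix (Fin 2) (Fin 2) K) 0 1) * ((k : GL (Fin 2) K) : Matrix (Fin 2) (Fin 2) K) 1 1 +
      σ (((k : GL (Fin 2) K) : Matrix (Fin 2) (Fin 2) K) 1 1) * ((k : GL (Fin 2) K) : Matrix (Fin 2) (Fin 2) K) 0 1 = 0 := by
  have h := sum_map_mul_rev_apply_eq k 1 1
  rw [Fin.sum_univ_two, rev_zero_two, rev_one_two, if_neg (by decide)] at h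
  exact h

omit [Valued K ℤᵐ⁰] in
/-- the two columns of `k ∈ U(σ, J₀)` pair to `1`: `σ(k₀₁)·k₁₀ + σ(k₁₁)·k₀₀ = 1`. [cite: Rogawski1990, §1.9 p. 13] -/
theorem col_pairing (k : unitaryGroupOfForm σ ((StdForm.antidiagonal 2).over K)) :
    σ (((k : GL (Fin 2) K) : Matrix (Fin 2) (Fin 2) K) 0 1) * ((k : GL (Fin 2) K) : Matrix (Fin 2) (Fin 2) K) 1 0 +
      σ (((k : GL (Fin 2) K) : Matrix (Fin 2) (Fin 2) K) 1 1) * ((k : GL (Fin 2) K) : Matrix (Fin 2) (Fin 2) K) 0 0 = 1 := by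
  have h := sum_map_mul_rev_apply_eq k 1 0
  rw [Fin.sum_univ_two, rev_zero_two, rev_one_two, if_pos rfl] at h
  exact h

omit [Valued K ℤᵐ⁰] in
/-- the inverse of `g ∈ U(σ, J₀)` (`N = 2`) as a `!![·]` matrix: `g⁻¹ = [[σ g₁₁, σ g₀₁], [σ g₁₀, σ g₀₀]]` (★ `coe_inv_apply_unitary`).
[cite: Rogawski1990, §1.9 p. 13] -/
theorem coe_inv_eq_two (g : unitaryGroupOfForm σ ((StdForm.antidiagonal 2).over K)) :
    (((g⁻¹ : unitaryGroupOfForm σ ((StdForm.antidiagonal 2).over K)) : GL (Fin 2) K) : Matrix (Fin 2) (Fin 2) K) =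
      !![σ (((g : GL (Fin 2) K) : Matrix (Fin 2) (Fin 2) K) 1 1), σ (((g : GL (Fin 2) K) : Matrix (Fin 2) (Fin 2) K) 0 1);
         σ (((g : GL (Fin 2) K) : Matrix (Fin 2) (Fin 2) K) 1 0), σ (((g : GL (Fin 2) K) : Matrix (Fin 2) (Fin 2) K) 0 0)] := by
  ext i j
  rw [coe_inv_apply_unitary]
  fin_cases i <;> fin_cases j <;> rfl

/-! ## §2 Tag A: a unit in the corner -/

/-- **TAG A.**  `b = diag(x, (σx)⁻¹)` with `v x = exp(−j)`; `k ∈ K₀` with `v(k₁₁) = 1`; `ρ'` anti-fixed integral with `v(k₀₁∕k₁₁ − ρ') ≤ exp(−2j)`.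
Then `k·b ∈ u(ρ')·b·K₀`: precisely `(u b)⁻¹ (k b) ∈ K₀` for the unipotent `u = u(ρ') ∈ K₀`. [cite: BruhatTits1972, (4.4.4)] [cite: Macdonald1971, Ch. V §3] -/
theorem exists_unipotent_rep (hσ : ∀ x, σ (σ x) = x) (hvσ : ∀ x, Valued.v (σ x) = Valued.v x)
    {x : K} {j : ℕ} (hx : Valued.v x = WithZero.exp (-(j : ℤ)))
    {b : unitaryGroupOfForm σ ((StdForm.antidiagonal 2).over K)} (hb : ((b : GL (Fin 2) K) : Matrix (Fin 2) (Fin 2) K) = Matrix.diagonal ![x, (σ x)⁻¹])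
    {k : unitaryGroupOfForm σ ((StdForm.antidiagonal 2).over K)} (hk : k ∈ unitaryInt σ ((StdForm.antidiagonal 2).over K))
    (hs : Valued.v (((k : GL (Fin 2) K) : Matrix (Fin 2) (Fin 2) K) 1 1) = 1)
    {ρ' : K} (hρ'1 : Valued.v ρ' ≤ 1) (hρ'σ : σ ρ' = -ρ')
    (hnear : Valued.v (((k : GL (Fin 2) K) : Matrix (Fin 2) (Fin 2) K) 0 1 * (((k : GL (Fin 2) K) : Matrix (Fin 2) (Fin 2) K) 1 1)⁻¹ - ρ') ≤
      WithZero.exp (-(2 * (j : ℤ)))) :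
    ∃ u : unitaryGroupOfForm σ ((StdForm.antidiagonal 2).over K),
      ((u : GL (Fin 2) K) : Matrix (Fin 2) (Fin 2) K) = !![1, ρ'; 0, 1] ∧ u ∈ unitaryInt σ ((StdForm.antidiagonal 2).over K) ∧
        (u * b)⁻¹ * (k * b) ∈ unitaryInt σ ((StdForm.antidiagonal 2).over K) := by
  -- names for the entries of `k`
  set p : K := ((k : GL (Fin 2) K) : Matrix (Fin 2) (Fin 2) K) 0 0 with hp
  set q : K := ((k : GL (Fin 2) K) : Matrix (Fin 2) (Fin 2) K) 0 1 with hq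
  set r : K := ((k : GL (Fin 2) K) : Matrix (Fin 2) (Fin 2) K) 1 0 with hr
  set s : K := ((k : GL (Fin 2) K) : Matrix (Fin 2) (Fin 2) K) 1 1 with hs'
  have hkM : ((k : GL (Fin 2) K) : Matrix (Fin 2) (Fin 2) K) = !![p, q; r, s] := Matrix.eta_fin_two _
  have hkint := (mem_unitaryInt_iff.1 hk).1
  have hvp : Valued.v p ≤ 1 := hkint 0 0
  have hvr : Valued.v r ≤ 1 := hkint 1 0
  have hvs : Valued.v s ≤ 1 := hkint 1 1
  have hs0 : s ≠ 0 := fun h => by rw [h, map_zero] at hs; exact zero_ne_one hs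
  have hx0 : x ≠ 0 := ne_zero_of_v_eq_exp hx
  have hσx0 : σ x ≠ 0 := map_ne_zero_of_vσ hvσ hx0
  -- the unipotent `u = u(ρ')`
  let u : unitaryGroupOfForm σ ((StdForm.antidiagonal 2).over K) := ⟨_, unipotent_mem_unitaryGroupOfForm hρ'σ⟩
  have huM : ((u : GL (Fin 2) K) : Matrix (Fin 2) (Fin 2) K) = !![1, ρ'; 0, 1] := rfl
  have huK : u ∈ unitaryInt σ ((StdForm.antidiagonal 2).over K) := by
    refine (mem_unitaryInt_iff_forall_v_le_one hvσ).2 fun i l => ?_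
    rw [huM]
    fin_cases i <;> fin_cases l <;> simp [hρ'1]
  refine ⟨u, huM, huK, (mem_unitaryInt_iff_forall_v_le_one hvσ).2 fun i l => ?_⟩
  -- the matrix of `(u b)⁻¹ (k b) = b⁻¹ u⁻¹ k b`
  have hbi : (((b⁻¹ : unitaryGroupOfForm σ ((StdForm.antidiagonal 2).over K)) : GL (Fin 2) K) : Matrix (Fin 2) (Fin 2) K) = !![x⁻¹, 0; 0, σ x] := by
    rw [coe_inv_eq_two, hb]
    simp [map_inv₀, hσ]
  have hui : (((u⁻¹ : unitaryGroupOfForm σ ((StdForm.antidiagonal 2).over K)) : GL (Fin 2) K) : Matrix (Fin 2) (Fin 2) K) = !![1, -ρ'; 0, 1] := by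
    rw [coe_inv_eq_two, huM]
    simp [hρ'σ]
  have hbM : ((b : GL (Fin 2) K) : Matrix (Fin 2) (Fin 2) K) = !![x, 0; 0, (σ x)⁻¹] := by
    rw [hb]; ext i l; fin_cases i <;> fin_cases l <;> simp
  have hM : ((((u * b)⁻¹ * (k * b) : unitaryGroupOfForm σ ((StdForm.antidiagonal 2).over K)) : GL (Fin 2) K) : Matrix (Fin 2) (Fin 2) K) =
      !![p - ρ' * r, x⁻¹ * (q - ρ' * s) * (σ x)⁻¹; σ x * r * x, s] := by
    rw [show (u * b)⁻¹ * (k * b) = b⁻¹ * u⁻¹ * k * b by group, Subgroup.coe_mul, Subgroup.coe_mul, Subgroup.coe_mul, Units.val_mul,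
      Units.val_mul, Units.val_mul, hbi, hui, hkM, hbM]
    simp only [Matrix.mul_fin_two]
    ext i l
    fin_cases i <;> fin_cases l
    · simp; field_simp; ring
    · simp; exact Or.inl (by ring)
    · simp
    · simp; field_simp
  rw [hM]
  -- the four entries are integral
  have hxx : Valued.v x⁻¹ * Valued.v (σ x)⁻¹ = WithZero.exp (2 * (j : ℤ)) := by
    rw [map_inv₀, map_inv₀, hvσ, hx, ← WithZero.exp_neg, ← WithZero.exp_add]
    congr 1; ring
  have hq' : q - ρ' * s = s * (q * s⁻¹ - ρ') := by field_simp
  fin_cases i <;> fin_cases l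
  · simpa using Valuation.map_sub_le _ hvp (by rw [map_mul]; exact mul_le_one' hρ'1 hvr)
  · simp only [Fin.zero_eta, Fin.isValue, Fin.mk_one, of_apply, cons_val', cons_val_one, cons_val_fin_one, cons_val_zero, map_mul, hq']
    calc Valued.v x⁻¹ * (Valued.v s * Valued.v (q * s⁻¹ - ρ')) * Valued.v (σ x)⁻¹
        = (Valued.v x⁻¹ * Valued.v (σ x)⁻¹) * (Valued.v s * Valued.v (q * s⁻¹ - ρ')) := by ac_rfl
      _ ≤ WithZero.exp (2 * (j : ℤ)) * (1 * WithZero.exp (-(2 * (j : ℤ)))) := by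
          rw [hxx]; exact mul_le_mul_right (mul_le_mul' hvs hnear) _
      _ = 1 := by rw [one_mul, ← WithZero.exp_add, add_neg_cancel, WithZero.exp_zero]
  · simp only [Fin.mk_one, Fin.isValue, Fin.zero_eta, of_apply, cons_val', cons_val_zero, cons_val_one, cons_val_fin_one, map_mul, hvσ, hx]
    calc WithZero.exp (-(j : ℤ)) * Valued.v r * WithZero.exp (-(j : ℤ)) ≤ 1 * 1 * 1 :=
          mul_le_mul' (mul_le_mul' (by rw [← WithZero.exp_zero, WithZero.exp_le_exp]; omega) hvr)
            (by rw [← WithZero.exp_zero, WithZero.exp_le_exp]; omega)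
      _ = 1 := by rw [mul_one, mul_one]
  · simpa using hvs

/-! ## §3 The cover of `K₀ b K₀` by `2 · #R₀` cosets -/

omit [Valued K ℤᵐ⁰] in
/-- the Weyl flip as a `!![·]` matrix. [folklore] -/
theorem permMatrix_swap_two : (Equiv.swap (0 : Fin 2) 1).permMatrix K = !![0, 1; 1, 0] := by
  ext i j
  fin_cases i <;> fin_cases j <;> simp

/-- in `K₀` a non-unit corner forces a unit above it: `v(k₁₁) < 1 ⇒ v(k₀₁) = 1` (the columns pair to `1`). [cite: Macdonald1971, Ch. V §3] -/
theorem v_apply_zero_one_eq_one (hvσ : ∀ x, Valued.v (σ x) = Valued.v x)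
    {k : unitaryGroupOfForm σ ((StdForm.antidiagonal 2).over K)} (hk : k ∈ unitaryInt σ ((StdForm.antidiagonal 2).over K))
    (hs : Valued.v (((k : GL (Fin 2) K) : Matrix (Fin 2) (Fin 2) K) 1 1) < 1) :
    Valued.v (((k : GL (Fin 2) K) : Matrix (Fin 2) (Fin 2) K) 0 1) = 1 := by
  have hkint := (mem_unitaryInt_iff.1 hk).1
  have h := col_pairing k
  -- `v(σ(k₁₁) k₀₀) < 1`, so `v(σ(k₀₁) k₁₀) = 1`
  have h1 : Valued.v (σ (((k : GL (Fin 2) K) : Matrix (Fin 2) (Fin 2) K) 1 1) * ((k : GL (Fin 2) K) : Matrix (Fin 2) (Fin 2) K) 0 0) < 1 := by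
    rw [map_mul, hvσ]
    calc Valued.v (((k : GL (Fin 2) K) : Matrix (Fin 2) (Fin 2) K) 1 1) * Valued.v (((k : GL (Fin 2) K) : Matrix (Fin 2) (Fin 2) K) 0 0)
        ≤ Valued.v (((k : GL (Fin 2) K) : Matrix (Fin 2) (Fin 2) K) 1 1) * 1 := mul_le_mul_right (hkint 0 0) _
      _ < 1 := by rw [mul_one]; exact hs
  have h2 : Valued.v (σ (((k : GL (Fin 2) K) : Matrix (Fin 2) (Fin 2) K) 0 1) * ((k : GL (Fin 2) K) : Matrix (Fin 2) (Fin 2) K) 1 0) = 1 := by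
    by_contra hne
    have hle : Valued.v (σ (((k : GL (Fin 2) K) : Matrix (Fin 2) (Fin 2) K) 0 1) * ((k : GL (Fin 2) K) : Matrix (Fin 2) (Fin 2) K) 1 0) ≤ 1 := by
      rw [map_mul, hvσ]; exact mul_le_one' (hkint 0 1) (hkint 1 0)
    have hlt := lt_of_le_of_ne hle hne
    have := Valuation.map_add_lt _ hlt h1
    rw [h, map_one] at this
    exact lt_irrefl _ this
  rw [map_mul, hvσ] at h2
  refine le_antisymm (hkint 0 1) ?_
  by_contra hlt
  push Not at hlt
  have : Valued.v (((k : GL (Fin 2) K) : Matrix (Fin 2) (Fin 2) K) 0 1) * Valued.v (((k : GL (Fin 2) K) : Matrix (Fin 2) (Fin 2) K) 1 0) < 1 :=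
    calc _ ≤ Valued.v (((k : GL (Fin 2) K) : Matrix (Fin 2) (Fin 2) K) 0 1) * 1 := mul_le_mul_right (hkint 1 0) _
      _ < 1 := by rw [mul_one]; exact hlt
  rw [h2] at this
  exact lt_irrefl _ this

/-- the ratio `k₀₁ ∕ k₁₁` of the second column of `k ∈ K₀` with unit corner is an ANTI-FIXED INTEGER. [cite: Rogawski1990, §1.10 p. 14] -/
theorem ratio_antifixed {k : unitaryGroupOfForm σ ((StdForm.antidiagonal 2).over K)} (hk : k ∈ unitaryInt σ ((StdForm.antidiagonal 2).over K))
    (hs : Valued.v (((k : GL (Fin 2) K) : Matrix (Fin 2) (Fin 2) K) 1 1) = 1) :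
    Valued.v (((k : GL (Fin 2) K) : Matrix (Fin 2) (Fin 2) K) 0 1 * (((k : GL (Fin 2) K) : Matrix (Fin 2) (Fin 2) K) 1 1)⁻¹) ≤ 1 ∧
      σ (((k : GL (Fin 2) K) : Matrix (Fin 2) (Fin 2) K) 0 1 * (((k : GL (Fin 2) K) : Matrix (Fin 2) (Fin 2) K) 1 1)⁻¹) =
        -(((k : GL (Fin 2) K) : Matrix (Fin 2) (Fin 2) K) 0 1 * (((k : GL (Fin 2) K) : Matrix (Fin 2) (Fin 2) K) 1 1)⁻¹) := by
  set q : K := ((k : GL (Fin 2) K) : Matrix (Fin 2) (Fin 2) K) 0 1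
  set s : K := ((k : GL (Fin 2) K) : Matrix (Fin 2) (Fin 2) K) 1 1
  have hs0 : s ≠ 0 := fun h => by rw [h, map_zero] at hs; exact zero_ne_one hs
  have hσs0 : σ s ≠ 0 := fun h => hs0 (by simpa using congrArg σ h |>.trans (map_zero σ) |> fun e => (RingHom.injective σ) (e.trans (map_zero σ).symm))
  refine ⟨?_, ?_⟩
  · rw [map_mul, map_inv₀, hs, inv_one, mul_one]; exact (mem_unitaryInt_iff.1 hk).1 0 1
  · have h := col_one_isotropic k
    change σ q * s + σ s * q = 0 at h
    rw [map_mul, map_inv₀]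
    field_simp
    linear_combination h

/-- **THE COVER.**  For `b = diag(x, (σx)⁻¹) ∈ U(σ, J₀)`, `v x = exp(−j)`, and a finite net `R₀` of the anti-fixed integers `𝒪⁰` modulo `v ≤ exp(−2j)`,
the double coset `K₀ b K₀` is contained in at most `2·#R₀` left cosets `(r b)·K₀`.  Consequence (F4): `ν(K₀ b K₀) ≤ 2·#R₀·ν(K₀)` for every
left-invariant measure `ν`. [cite: BruhatTits1972, (4.4.4)] [cite: Macdonald1971, Ch. V §3] [cite: SerreTrees1980, II.1.1] -/
theorem doubleCoset_subset_biUnion_cosets (hσ : ∀ x, σ (σ x) = x) (hvσ : ∀ x, Valued.v (σ x) = Valued.v x)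
    {x : K} {j : ℕ} (hx : Valued.v x = WithZero.exp (-(j : ℤ)))
    {b : unitaryGroupOfForm σ ((StdForm.antidiagonal 2).over K)} (hb : ((b : GL (Fin 2) K) : Matrix (Fin 2) (Fin 2) K) = Matrix.diagonal ![x, (σ x)⁻¹])
    (R₀ : Finset K) (hR₀ : ∀ ρ ∈ R₀, Valued.v ρ ≤ 1 ∧ σ ρ = -ρ)
    (hnet : ∀ ρ : K, Valued.v ρ ≤ 1 → σ ρ = -ρ → ∃ ρ' ∈ R₀, Valued.v (ρ - ρ') ≤ WithZero.exp (-(2 * (j : ℤ)))) :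
    ∃ R : Finset (unitaryGroupOfForm σ ((StdForm.antidiagonal 2).over K)), R.card ≤ 2 * R₀.card ∧
      DoubleCoset.doubleCoset b (unitaryInt σ ((StdForm.antidiagonal 2).over K) : Set _) (unitaryInt σ ((StdForm.antidiagonal 2).over K)) ⊆
        ⋃ r ∈ R, (fun y => (r * b)⁻¹ * y) ⁻¹' (unitaryInt σ ((StdForm.antidiagonal 2).over K) : Set (unitaryGroupOfForm σ ((StdForm.antidiagonal 2).over K))) := by
  classical
  -- the unipotents `u(ρ)`, `ρ ∈ R₀` (anti-fixed), and the Weyl flip `W`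
  let uU : K → unitaryGroupOfForm σ ((StdForm.antidiagonal 2).over K) := fun ρ =>
    if h : σ ρ = -ρ then ⟨_, unipotent_mem_unitaryGroupOfForm h⟩ else 1
  have huU : ∀ ρ, σ ρ = -ρ → ((uU ρ : GL (Fin 2) K) : Matrix (Fin 2) (Fin 2) K) = !![1, ρ; 0, 1] := by
    intro ρ h; simp only [uU, dif_pos h]
  let W : unitaryGroupOfForm σ ((StdForm.antidiagonal 2).over K) := ⟨permGL (Equiv.swap (0 : Fin 2) 1), permGL_mem_unitaryGroupOfForm _ swap_rev⟩
  have hW : W ∈ unitaryInt σ ((StdForm.antidiagonal 2).over K) := permGL_mem_unitaryInt _ swap_rev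
  have hWM : ((W : GL (Fin 2) K) : Matrix (Fin 2) (Fin 2) K) = !![0, 1; 1, 0] := by
    change ((permGL (Equiv.swap (0 : Fin 2) 1) : GL (Fin 2) K) : Matrix (Fin 2) (Fin 2) K) = _
    rw [coe_permGL, permMatrix_swap_two]
  refine ⟨R₀.image uU ∪ R₀.image (fun ρ => W * uU ρ), ?_, ?_⟩
  · calc (R₀.image uU ∪ R₀.image (fun ρ => W * uU ρ)).card ≤ (R₀.image uU).card + (R₀.image (fun ρ => W * uU ρ)).card :=
          Finset.card_union_le _ _
      _ ≤ R₀.card + R₀.card := Nat.add_le_add Finset.card_image_le Finset.card_image_le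
      _ = 2 * R₀.card := by ring
  -- TAG A for an element `k ∈ K₀` with unit corner: `k b k₂ ∈ (u(ρ') b) K₀`
  have tagA : ∀ k k₂ : unitaryGroupOfForm σ ((StdForm.antidiagonal 2).over K), k ∈ unitaryInt σ ((StdForm.antidiagonal 2).over K) →
      k₂ ∈ unitaryInt σ ((StdForm.antidiagonal 2).over K) → Valued.v (((k : GL (Fin 2) K) : Matrix (Fin 2) (Fin 2) K) 1 1) = 1 →
      ∃ ρ' ∈ R₀, (uU ρ' * b)⁻¹ * (k * b * k₂) ∈ unitaryInt σ ((StdForm.antidiagonal 2).over K) := by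
    intro k k₂ hk hk₂ hs
    obtain ⟨hρ1, hρσ⟩ := ratio_antifixed hk hs
    obtain ⟨ρ', hρ'R, hnear⟩ := hnet _ hρ1 hρσ
    obtain ⟨u, huM', huK, hmem⟩ := exists_unipotent_rep hσ hvσ hx hb hk hs (hR₀ ρ' hρ'R).1 (hR₀ ρ' hρ'R).2 hnear
    have hu : u = uU ρ' := Subtype.ext (Units.ext (by rw [huM', huU ρ' (hR₀ ρ' hρ'R).2]))
    refine ⟨ρ', hρ'R, ?_⟩
    rw [← hu, show (u * b)⁻¹ * (k * b * k₂) = (u * b)⁻¹ * (k * b) * k₂ by group]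
    exact Subgroup.mul_mem _ hmem hk₂
  -- the cover
  intro g hg
  obtain ⟨k, hk, k₂, hk₂, rfl⟩ := DoubleCoset.mem_doubleCoset.1 hg
  simp only [Set.mem_iUnion, Set.mem_preimage, Finset.mem_union, Finset.mem_image, SetLike.mem_coe]
  by_cases hs : Valued.v (((k : GL (Fin 2) K) : Matrix (Fin 2) (Fin 2) K) 1 1) = 1
  · obtain ⟨ρ', hρ'R, hmem⟩ := tagA k k₂ hk hk₂ hs
    exact ⟨uU ρ', Or.inl ⟨ρ', hρ'R, rfl⟩, hmem⟩
  · -- TAG B: flip first (`(W k)₁₁ = k₀₁` is a unit)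
    have hs' : Valued.v (((k : GL (Fin 2) K) : Matrix (Fin 2) (Fin 2) K) 1 1) < 1 := lt_of_le_of_ne ((mem_unitaryInt_iff.1 hk).1 1 1) hs
    have hq := v_apply_zero_one_eq_one hvσ hk hs'
    have hWk : Valued.v ((((W * k : unitaryGroupOfForm σ ((StdForm.antidiagonal 2).over K)) : GL (Fin 2) K) : Matrix (Fin 2) (Fin 2) K) 1 1) = 1 := by
      rw [Subgroup.coe_mul, Units.val_mul, hWM, Matrix.eta_fin_two ((k : GL (Fin 2) K) : Matrix (Fin 2) (Fin 2) K), Matrix.mul_fin_two]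
      simpa using hq
    obtain ⟨ρ', hρ'R, hmem⟩ := tagA (W * k) k₂ (Subgroup.mul_mem _ hW hk) hk₂ hWk
    refine ⟨W * uU ρ', Or.inr ⟨ρ', hρ'R, rfl⟩, ?_⟩
    have hWW : W * W = 1 := by
      apply Subtype.ext; apply Units.ext
      rw [Subgroup.coe_mul, Units.val_mul, hWM, OneMemClass.coe_one, Units.val_one]
      simp [Matrix.one_fin_two]
    have hWinv : W⁻¹ = W := by rw [inv_eq_iff_mul_eq_one, hWW]
    have : (W * uU ρ' * b)⁻¹ * (k * b * k₂) = (uU ρ' * b)⁻¹ * (W * k * b * k₂) := by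
      rw [show (W * uU ρ' * b)⁻¹ = (uU ρ' * b)⁻¹ * W⁻¹ by group, hWinv]; group
    rw [this]
    exact hmem

end Summit.HodgeConjecture.HodgeConjecture.Cruxes.HLiu418.K2LiuRankOneCosetCoverAnyPlace

end
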